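import Literature.Computability.Complexity.MatchingExtensionComplexityProofs
import Literature.Barriers.PneNP.TSPExtensionComplexityMatchingFace
import Literature.Barriers.PneNP.TSPExtensionComplexityRothvossProofs
import HarnessLib

/-!
# Rothvoss's theorem holds (slack form): discharge of `rothvoss_matching_slack_bound`

`theorem rothvoss_matching_slack_bound_holds : rothvoss_matching_slack_bound` — T. Rothvoss, *The
matching polytope has exponential extension complexity*, J. ACM 64 (2017) 41, **Theorem 1** in the
slack-matrix form of `MatchingExtensionComplexity.lean`: the odd-cut slack matrix
`S_{U,M} = |M ∩ δ(U)| - 1` of `K_n` has non-negative rank `> 2^{cn}` for all large even `n`.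

Nothing is re-proved here. The hard part of the paper (§3: Lemmas 6–7, the pseudo-random
partition argument) is ALREADY kernel-checked in the tree, for the TSP barrier fact
`Literature.Barriers.PneNP.Rothvoss2017_tsp` (`TSPExtensionComplexityRothvoss*.lean`): on the slot
model `Slot m 72` (`n = 216 m + 150` vertices, `k = 75`, `t = 72 (μ+1) + 3`, `m = 2μ + 1`) the
weight matrix of §2 has ALL rectangle sums `≤ 2 θ`, `θ = 2^{-δ m}`, and `⟨W, S⟩ = 1`
(`Literature.Barriers.PneNP.exists_W_slot`, transported to any vertex type by
`exists_weights_transport`). And the outer layer "(2) + Lemma 6 ⇒ Theorem 1 (slack form), every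
even `n`" is `rothvoss_matching_slack_bound_of_rectangle_bound`
(`MatchingExtensionComplexityProofs.lean`). This file is the GLUE between the two vocabularies:

* `Rothvoss.edgeF M` — the edge finset of a subgraph of `K_n`; for a perfect matching `M`
  (Mathlib's `Subgraph.IsPerfectMatching`) it is a perfect matching in the edge-set sense
  `Literature.Barriers.PneNP.IsPMOn univ` (`isPMOn_edgeF`), every edge-set perfect matching arises
  this way (`exists_eq_edgeF`), injectively (`edgeF_injective`), whence the equivalence `pmEquivF`;
* `Rothvoss.crossing_eq_card_filter_cutCount` — `|M ∩ δ(U)| = #{e ∈ M : cutCount U e = 1}`;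
* `rothvoss_matching_slack_bound_holds` — with `k = 75` (`rvN 75 m = |Slot m 72|`,
  `rvT 75 m = tCut 72 μ`) and `δ = δ_R / 2` (`2 · 2^{-δ_R m} ≤ 2^{-δ_R m / 2}` for `m ≥ 2/δ_R`).

Consumer in the tree: `Summits/PneNP/PneNP/Theorems/ConvexRankGatesConvexGateBlindUnitPotentialLP.lean`
(`stub_unitPotentialHard_lp`, the LP slice of the unit-potential stub of crux `ConvexGateBlind`),
which thereby becomes unconditional.

## References

* [Rothvoss2017] T. Rothvoss, J. ACM 64(6) (2017) 41 (arXiv:1311.2369v3), Thm. 1, §2–§3.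
-/

noncomputable section

namespace Literature.Computability.Complexity

open Finset Filter Literature.Barriers.PneNP Literature.Probability.LatticeModels

namespace Rothvoss

variable {n : ℕ}

/-! ### Edge finsets of perfect matchings -/

/-- The edge set of a subgraph of `K_n`, as a `Finset`. [folklore] -/
def edgeF (M : (⊤ : SimpleGraph (Fin n)).Subgraph) : Finset (Sym2 (Fin n)) :=
  M.edgeSet.toFinite.toFinset

/-- Membership in `edgeF`. [folklore] -/
theorem mem_edgeF {M : (⊤ : SimpleGraph (Fin n)).Subgraph} {e : Sym2 (Fin n)} :
    e ∈ edgeF M ↔ e ∈ M.edgeSet :=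
  Set.Finite.mem_toFinset _

/-- `{a, b} ∈ edgeF M ↔ M.Adj a b`. [folklore] -/
theorem mk_mem_edgeF {M : (⊤ : SimpleGraph (Fin n)).Subgraph} {a b : Fin n} :
    s(a, b) ∈ edgeF M ↔ M.Adj a b := by
  rw [mem_edgeF, SimpleGraph.Subgraph.mem_edgeSet]

/-- **The edge finset of a perfect matching is a perfect matching in the edge-set sense**
(`IsPMOn univ`): no loops (edges of `K_n`) and every vertex has exactly one partner.
[folklore] -/
theorem isPMOn_edgeF {M : (⊤ : SimpleGraph (Fin n)).Subgraph} (hM : M.IsPerfectMatching) :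
    IsPMOn (univ : Finset (Fin n)) (edgeF M) := by
  refine isPMOn_univ_of_existsUnique (fun e he => ?_) (fun v => ?_)
  · induction e using Sym2.ind with
    | h a b =>
      rw [Sym2.mk_isDiag_iff]
      exact (M.adj_sub (mk_mem_edgeF.1 he)).ne
  · refine ⟨matchPartner hM v, mk_mem_edgeF.2 (adj_matchPartner hM v), fun w hw => ?_⟩
    exact eq_matchPartner_of_adj hM (mk_mem_edgeF.1 hw)

/-- A perfect matching of `K_n` is determined by its edge finset. [folklore] -/
theorem edgeF_injective {M₁ M₂ : (⊤ : SimpleGraph (Fin n)).Subgraph} (h₁ : M₁.IsPerfectMatching)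
    (h₂ : M₂.IsPerfectMatching) (h : edgeF M₁ = edgeF M₂) : M₁ = M₂ := by
  refine SimpleGraph.Subgraph.ext ?_ ?_
  · ext v
    exact ⟨fun _ => h₂.2 v, fun _ => h₁.2 v⟩
  · ext a b
    rw [← mk_mem_edgeF, ← mk_mem_edgeF, h]

/-- **Every edge-set perfect matching is the edge finset of a perfect matching** (the partner map
of `IsPMOn` is an adjacency-respecting involution of `K_n`, `partnerSubgraph`). [folklore] -/
theorem exists_eq_edgeF {Mf : Finset (Sym2 (Fin n))} (h : IsPMOn (univ : Finset (Fin n)) Mf) :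
    ∃ M : (⊤ : SimpleGraph (Fin n)).Subgraph, M.IsPerfectMatching ∧ edgeF M = Mf := by
  have hf : ∀ v, (⊤ : SimpleGraph (Fin n)).Adj v (h.partner v) ∧ h.partner (h.partner v) = v :=
    fun v => ⟨(SimpleGraph.top_adj _ _).2 (h.partner_ne v).symm, h.partner_partner v⟩
  refine ⟨partnerSubgraph ⊤ h.partner hf, partnerSubgraph_isPerfectMatching ⊤ h.partner hf, ?_⟩
  ext e
  induction e using Sym2.ind with
  | h a b =>
    rw [mk_mem_edgeF]
    change b = h.partner a ↔ s(a, b) ∈ Mf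
    exact ⟨fun hb => hb ▸ h.mk_partner_mem a, fun hab => h.eq_partner_of_mem hab⟩

/-- The perfect matchings of `K_n` as subgraphs (Mathlib) and as edge finsets (the tree's `IsPMOn`)
are in bijection via `edgeF`. [folklore] -/
def pmEquivF (n : ℕ) :
    {M : (⊤ : SimpleGraph (Fin n)).Subgraph // M.IsPerfectMatching} ≃
      {Mf : Finset (Sym2 (Fin n)) // IsPMOn (univ : Finset (Fin n)) Mf} :=
  Equiv.ofBijective (fun M => ⟨edgeF M.1, isPMOn_edgeF M.2⟩)
    ⟨fun M₁ M₂ h => Subtype.ext (edgeF_injective M₁.2 M₂.2 (congrArg Subtype.val h)),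
     fun Mf => by
      obtain ⟨M, hM, hMf⟩ := exists_eq_edgeF Mf.2
      exact ⟨⟨M, hM⟩, Subtype.ext hMf⟩⟩

/-- `pmEquivF` on an element (definitional). [folklore] -/
@[simp] theorem pmEquivF_apply_val (M : {M : (⊤ : SimpleGraph (Fin n)).Subgraph // M.IsPerfectMatching}) :
    ((pmEquivF n M : {Mf : Finset (Sym2 (Fin n)) // IsPMOn (univ : Finset (Fin n)) Mf}) :
      Finset (Sym2 (Fin n))) = edgeF M.1 := rfl

/-! ### The crossing number through `cutCount` -/

/-- `|M ∩ δ(U)| = #{e ∈ M : e has exactly one endpoint in U}` — the crossing number of the fact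
(`Rothvoss.crossing`, an `ncard`) in the `cutCount` currency of the TSP files. [folklore] -/
theorem crossing_eq_card_filter_cutCount (U : Finset (Fin n)) (M : (⊤ : SimpleGraph (Fin n)).Subgraph) :
    crossing U M = ((edgeF M).filter fun e => cutCount U e = 1).card := by
  classical
  unfold crossing
  rw [← Set.ncard_coe_finset]
  congr 1
  ext e
  simp only [Set.mem_inter_iff, Set.mem_setOf_eq, coe_filter, mem_edgeF]
  refine and_congr_right fun _ => ?_
  induction e using Sym2.ind with
  | h a b =>
    rw [cutCount_mk]
    constructor
    · rintro ⟨x, hx, y, hy, hxy⟩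
      rcases Sym2.eq_iff.1 hxy with ⟨rfl, rfl⟩ | ⟨rfl, rfl⟩
      · simp [hx, hy]
      · simp [hx, hy]
    · intro h
      by_cases ha : a ∈ U <;> by_cases hb : b ∈ U
      · simp [ha, hb] at h
      · exact ⟨a, ha, b, hb, rfl⟩
      · exact ⟨b, hb, a, ha, Sym2.eq_swap⟩
      · simp [ha, hb] at h

end Rothvoss

open Rothvoss

/-! ### Parameters `k = 75`, `q = 72` -/

/-- `rvN 75 m = |Slot m 72| = 216 m + 150`. [cite: Rothvoss2017, §2 (PDF p. 6)] -/
theorem card_slot_eq_rvN (m : ℕ) : Fintype.card (Slot m qR) = rvN 75 m := by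
  rw [Slot.card]
  unfold qR rvN
  ring

/-- `rvT 75 (2μ+1) = tCut 72 μ = 72 (μ+1) + 3`. [cite: Rothvoss2017, §2 (PDF p. 6)] -/
theorem rvT_eq_tCut (μ : ℕ) : rvT 75 (2 * μ + 1) = tCut qR μ := by
  unfold rvT tCut qR
  have : (2 * μ + 1 + 1) / 2 = μ + 1 := by omega
  rw [this]

/-- `2 · 2^{-δ m} ≤ 2^{-(δ/2) m}` once `δ m ≥ 2`. [folklore] -/
theorem two_mul_rpow_neg_le {δ x : ℝ} (h : 2 ≤ δ * x) :
    2 * (2 : ℝ) ^ (-(δ * x)) ≤ (2 : ℝ) ^ (-(δ / 2 * x)) := by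
  have h2 : (0 : ℝ) < 2 := by norm_num
  calc 2 * (2 : ℝ) ^ (-(δ * x)) = (2 : ℝ) ^ (1 + -(δ * x)) := by
        rw [Real.rpow_add h2, Real.rpow_one]
    _ ≤ (2 : ℝ) ^ (-(δ / 2 * x)) :=
        Real.rpow_le_rpow_of_exponent_le (by norm_num) (by linarith)

/-- A sum of a `dite` supported on `p` is the sum over the subtype of `p`. [folklore] -/
theorem sum_dite_eq_sum_subtype {α β : Type*} [Fintype α] [AddCommMonoid β] (p : α → Prop)
    [DecidablePred p] (g : {a // p a} → β) :
    ∑ a, (if h : p a then g ⟨a, h⟩ else 0) = ∑ b : {a // p a}, g b := by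
  have h1 : ∑ a, (if h : p a then g ⟨a, h⟩ else 0) =
      ∑ a ∈ univ.filter p, (if h : p a then g ⟨a, h⟩ else 0) := by
    refine (Finset.sum_subset (filter_subset _ _) fun a _ ha => ?_).symm
    rw [dif_neg (fun h => ha (mem_filter.2 ⟨mem_univ _, h⟩))]
  rw [h1, Finset.sum_subtype (p := p) (univ.filter p) (fun x => by simp)
    (f := fun a => if h : p a then g ⟨a, h⟩ else 0)]
  exact Finset.sum_congr rfl fun b _ => by rw [dif_pos b.2]

/-! ### The discharge -/

/-- **Rothvoss 2017, Theorem 1 (slack form) holds**: the odd-cut slack matrix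
`S_{U,M} = |M ∩ δ(U)| - 1` of `K_n` has no non-negative factorisation with `≤ 2^{cn}` terms, for
some `c > 0` and all large even `n`. Glue: the rectangle datum of §2–§3 proved for the TSP barrier
(`Literature.Barriers.PneNP.exists_W_slot`, all rectangle sums `≤ 2θ`, `⟨W,S⟩ = 1`) feeds
`rothvoss_matching_slack_bound_of_rectangle_bound` with `k = 75`, `δ = δ_R/2`.
[cite: Rothvoss2017, Thm. 1] -/
theorem rothvoss_matching_slack_bound_holds : rothvoss_matching_slack_bound := by
  refine rothvoss_matching_slack_bound_of_rectangle_bound ⟨75, by decide, by norm_num, δR / 2,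
    half_pos δR_pos, ?_⟩
  have hq : 0 < qR := by unfold qR; norm_num
  have hqe : Even qR := by unfold qR; decide
  have hε : (0 : ℝ) < εR := by unfold εR; norm_num
  -- largeness thresholds
  set T : ℝ := max (max ((64 / cU εR) ^ 2) (32 / cU εR))
    (max (16 * FQ * Real.log QB / cM qR εR) (2 / δR)) with hT
  filter_upwards [eventually_ge_atTop ⌈T⌉₊] with m hm hmo
  have hmT : T ≤ (m : ℝ) := (Nat.le_ceil T).trans (by exact_mod_cast hm)
  have hU1 : (64 / cU εR) ^ 2 ≤ (m : ℝ) + 1 := by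
    linarith [le_trans (le_trans (le_max_left _ _) (le_max_left _ _)) hmT]
  have hU2 : 32 / cU εR ≤ (m : ℝ) + 1 := by
    linarith [le_trans (le_trans (le_max_right _ _) (le_max_left _ _)) hmT]
  have hM1 : 16 * FQ * Real.log QB / cM qR εR ≤ (m : ℝ) :=
    le_trans (le_trans (le_max_left _ _) (le_max_right _ _)) hmT
  have hδm : 2 ≤ δR * m := by
    have h1 : 2 / δR ≤ (m : ℝ) := le_trans (le_trans (le_max_right _ _) (le_max_right _ _)) hmT
    rwa [div_le_iff₀ δR_pos, mul_comm] at h1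
  -- `m = 2μ + 1`
  obtain ⟨μ, rfl⟩ := hmo
  have hm : 2 * μ + 1 = 2 * μ + 1 := rfl
  -- the weight datum of §2–§3 on `Fin (rvN 75 m)`
  let e : Slot (2 * μ + 1) qR ≃ Fin (rvN 75 (2 * μ + 1)) :=
    (Fintype.equivFin _).trans (finCongr (card_slot_eq_rvN _))
  obtain ⟨W', hrect, hsum⟩ := exists_weights_transport e (tCut qR μ) (2 * θR (2 * μ + 1)) 1
    (exists_W_slot (m := 2 * μ + 1) (q := qR) μ εR (θR (2 * μ + 1)) hq hqe hm hε (θR_pos _)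
      (θR_le_one _) (betaU_ok μ hm hU1 hU2) (betaM_ok hM1) hk_num)
  classical
  -- the weight on (vertex sets) × (subgraphs), zero off (t-cuts) × (perfect matchings)
  let Φ := pmEquivF (rvN 75 (2 * μ + 1))
  let F : {U : Finset (Fin (rvN 75 (2 * μ + 1))) // U.card = (tCut qR μ)} →
      {Mf : Finset (Sym2 (Fin (rvN 75 (2 * μ + 1)))) // IsPMOn (univ : Finset (Fin (rvN 75 (2 * μ + 1)))) Mf} → ℝ := fun a b =>
    W' a b * ((((b : Finset (Sym2 (Fin (rvN 75 (2 * μ + 1))))).filter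
      fun f => cutCount (a : Finset (Fin (rvN 75 (2 * μ + 1)))) f = 1).card : ℝ) - 1)
  have hsum' : ∑ a, ∑ b, F a b = 1 := hsum
  let W : Finset (Fin (rvN 75 (2 * μ + 1))) → (⊤ : SimpleGraph (Fin (rvN 75 (2 * μ + 1)))).Subgraph → ℝ := fun U M =>
    if hU : U.card = (tCut qR μ) then
      if hM : M.IsPerfectMatching then W' ⟨U, hU⟩ (Φ ⟨M, hM⟩) else 0
    else 0
  have hWdef : ∀ U M, W U M = if hU : U.card = (tCut qR μ) then
      if hM : M.IsPerfectMatching then W' ⟨U, hU⟩ (Φ ⟨M, hM⟩) else 0 else 0 := fun _ _ => rfl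
  have htT : rvT 75 (2 * μ + 1) = (tCut qR μ) := rvT_eq_tCut μ
  refine ⟨W, fun U M hW => ?_, ?_, fun 𝓤 𝓜 h𝓤 h𝓜 _ => ?_⟩
  · -- support
    rw [hWdef] at hW
    by_cases hU : U.card = (tCut qR μ)
    · by_cases hM : M.IsPerfectMatching
      · exact ⟨hU.trans htT.symm, hM⟩
      · rw [dif_pos hU, dif_neg hM] at hW; exact absurd rfl hW
    · rw [dif_neg hU] at hW; exact absurd rfl hW
  · -- `⟨W, S⟩ = 1`
    -- columns: for a `t`-cut only perfect matchings contribute, reindexed along `pmEquivF`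
    have hrow : ∀ U : Finset (Fin (rvN 75 (2 * μ + 1))), ∑ M, W U M * ((crossing U M : ℝ) - 1) =
        if hU : U.card = (tCut qR μ) then ∑ b, F ⟨U, hU⟩ b else 0 := by
      intro U
      by_cases hU : U.card = (tCut qR μ)
      · rw [dif_pos hU]
        have hcol : ∀ M : (⊤ : SimpleGraph (Fin (rvN 75 (2 * μ + 1)))).Subgraph, W U M * ((crossing U M : ℝ) - 1) =
            if hM : M.IsPerfectMatching then F ⟨U, hU⟩ (Φ ⟨M, hM⟩) else 0 := by
          intro M
          rw [hWdef, dif_pos hU]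
          by_cases hM : M.IsPerfectMatching
          · rw [dif_pos hM, dif_pos hM, crossing_eq_card_filter_cutCount]
            rfl
          · rw [dif_neg hM, dif_neg hM, zero_mul]
        rw [Finset.sum_congr rfl fun M _ => hcol M,
          sum_dite_eq_sum_subtype (fun M : (⊤ : SimpleGraph (Fin (rvN 75 (2 * μ + 1)))).Subgraph => M.IsPerfectMatching)
            (fun c => F ⟨U, hU⟩ (Φ c))]
        exact Φ.sum_comp (F ⟨U, hU⟩)
      · rw [dif_neg hU]
        refine Finset.sum_eq_zero fun M _ => ?_
        rw [hWdef, dif_neg hU, zero_mul]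
    have htot : ∑ U, ∑ M, W U M * ((crossing U M : ℝ) - 1) = ∑ a, ∑ b, F a b := by
      rw [Finset.sum_congr rfl fun U _ => hrow U]
      exact sum_dite_eq_sum_subtype (fun U : Finset (Fin (rvN 75 (2 * μ + 1))) => U.card = (tCut qR μ)) (fun a => ∑ b, F a b)
    rw [htot, hsum']
  · -- rectangles of `t`-cuts × perfect matchings: transport to the subtypes and apply `hrect`
    have h𝓤' : ∀ U ∈ 𝓤, U.card = tCut qR μ := fun U hU => (h𝓤 U hU).trans htT
    have step1 : ∑ U ∈ 𝓤, ∑ M ∈ 𝓜, W U M =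
        ∑ a ∈ 𝓤.subtype (fun U => U.card = tCut qR μ), ∑ M ∈ 𝓜, W a.1 M := by
      rw [Finset.sum_subtype_eq_sum_filter (f := fun U => ∑ M ∈ 𝓜, W U M),
        Finset.filter_true_of_mem h𝓤']
    have step2 : ∀ a : {U : Finset (Fin (rvN 75 (2 * μ + 1))) // U.card = tCut qR μ},
        ∑ M ∈ 𝓜, W a.1 M =
          ∑ b ∈ (𝓜.subtype fun M => M.IsPerfectMatching).map Φ.toEmbedding, W' a b := by
      intro a
      rw [Finset.sum_map, show ∑ M ∈ 𝓜, W a.1 M =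
          ∑ M ∈ 𝓜.filter (fun M => M.IsPerfectMatching), W a.1 M by
            rw [Finset.filter_true_of_mem h𝓜],
        ← Finset.sum_subtype_eq_sum_filter]
      refine Finset.sum_congr rfl fun c _ => ?_
      rw [hWdef, dif_pos a.2, dif_pos c.2]
      rfl
    rw [step1, Finset.sum_congr rfl fun a _ => step2 a]
    exact (hrect _ _).trans (two_mul_rpow_neg_le hδm)

end Literature.Computability.Complexity

end
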